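import Summits.CriticalPhenomena.PercolationContinuityZ3.Theses.PercLowPointHalfSpace
import Summits.CriticalPhenomena.PercolationContinuityZ3.Theses.PercNonProliferation
import Summits.CriticalPhenomena.PercolationContinuityZ3.Theses.PercDivergentSlabLadder
import Summits.CriticalPhenomena.PercolationContinuityZ3.Theorems.BoundaryTwoArmDecay.Negative.LoadBearing
import Summits.CriticalPhenomena.PercolationContinuityZ3.Theorems.BoundaryTwoArmDecay.Negative.SecondArm
import Literature.Probability.Percolation.HalfSpacePinnedPairs
import Summits.CriticalPhenomena.PercolationContinuityZ3.Theorems.PercLowPointHalfSpaceBoundaryTwoArmDecayStubReach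
import Summits.CriticalPhenomena.PercolationContinuityZ3.Theorems.PercLowPointHalfSpaceBoundaryTwoArmDecayStubStep
import Summits.CriticalPhenomena.PercolationContinuityZ3.Theorems.PercLowPointHalfSpaceBoundaryTwoArmDecayStubCensus
import Summits.CriticalPhenomena.PercolationContinuityZ3.Theorems.PercLowPointHalfSpaceBoundaryTwoArmDecayStubTallDensity
import Summits.CriticalPhenomena.PercolationContinuityZ3.Theorems.PercLowPointHalfSpaceBoundaryTwoArmDecayKTailReduction
import Summits.CriticalPhenomena.PercolationContinuityZ3.Theorems.PercLowPointHalfSpaceBoundaryTwoArmDecayStubKTailOfDecoupling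

/-!
# Skeleton of line `staircase-bootstrap-floor-decoupling` for crux `PercLowPointHalfSpace.BoundaryTwoArmDecay`
# (stmt-CriticalPhenomena-0911) — RESHAPED by lead c1 (2026-08-17): `{Q, Q_conf, step} ↦ {KTail, directStep}`

Crux (A): `∃ κ C, 0 < κ ∧ ∀ r ≥ 1, P_{p_c(ℤ³)}(E r) ≤ C r^{-(5/2+κ)}`,
`E r = {arm_ℍ(0,r) ∧ arm_ℍ(e,r) ∧ 0 ↮_ℍ e}` (landed `Negative.E`, `Negative.boundaryTwoArmDecay_iff` by `Iff.rfl`),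
`ℍ = halfSpace 3 = {z | 0 ≤ z 0}`, `e = Pi.single 1 1`, `P = μ = bondPercolation (zdGraph 3) (criticalProbI 3)`.

## The line (probabilities at `p_c(ℤ³)`; `U = C_ℍ(0)`; `A_n := kissV n 0 1` = both `ℍ`-clusters of the floor roots `0, e`
## meet LEVEL `n` and are distinct — the crux event with sup-reach replaced by height; `K_n` = number of partner-kiss
## floor edges of `U` (edges `q₁q₂`, `q₁ ∈ U ∌ q₂`, `C_ℍ(q₂)` n-tall); `e_n = E[1{height U = n}/|U ∩ ∂ℍ|]`, `ν_n = Σ_{m ≥ n} e_m`)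

  CENSUS       `P(A_n ∧ K_n ≤ k) ≤ C·k·e_n`  (all `n, k ≥ 1`; `C = 2/p_c³`)          `stub_census`      LANDED p132078
  TALL DENSITY `SubpolynomialBlocking → ∀ s > 0, ν_n ≤ C_s n^{s-2}`                  `stub_tallDensity` LANDED p131461
  KTAIL        `∀ s > 0, eventually n^{-s} P(A_n) ≤ P(A_n ∧ K_n ≤ ⌈n^s⌉)`            `stub_kTail`       NEW conjecture (OPEN; held by the lead)
      "subpolynomial partner-kiss multiplicity in probability": a polynomially non-negligible part of the kiss event has few
      partner-kiss edges.  It is the ONE statement the old pair (Q, Q_conf) was consumed for (see `stub_kTailOfDecoupling`),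
      and it is what separates the kernel-checked merger-DENSITY form Â of the crux (`stub_kissDensityDecay`, p132481:
      `SubpolynomialBlocking → κ_n ≤ C_s n^{s-3}`) from the EDGE form A.  MC (lead a5, kit j020916/…/j020920): on `A_n`,
      mean `K_n = 4.82 / 4.32 / 4.03` at `n = 8 / 16 / 32` (O(1), decreasing), `P(K_16 ≤ 16 | A_16) = 0.995`.  Heuristic:
      `E[K_n | A_n] ≍ Σ_r r^{1-a₂} < ∞ ⟺ a₂ > 2` (floor dimension 2; the 2D analogue — half-plane 3-arm exponent 2 > 1 — is a theorem).
  DIRECT STEP  `SubpolynomialBlocking → KTail → ∀ σ > 0, AprioriV (3 - σ)`            `stub_directStep`  LANDED p140944 (lead c1; file …KTailReduction.lean)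
      KTail at loss `s`, the census with `k = ⌈n^s⌉`: `P(A_n) ≤ 2C n^{2s} e_n` eventually; dyadic averaging (`A_n` antitone,
      `Σ_{m∈[N,2N]} e_m ≤ ν_N ≤ C_t N^{t-2}`, `StubStep.even_bound`) and `StubStep.decay_of_eventually`: `AprioriV (3 - 3s - t)`.
      NO staircase, NO seed, NO Q, NO Q_conf: the exponent `3 - σ` comes in one stroke from the census and 4446.
  SLAB         `∃ A ∈ [1, 6/5), SlabCrossover A` (= stmt-6700 with its free exponent CAPPED below 6/5) `stub_slab`  OPEN (shared debt with stmt-6700⁺)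
  REACH        `A ≥ 1 → SlabCrossover A → 0 < b → b·A < a → AprioriV a → Apriori b`  `stub_reach`       LANDED p130902
  BRIDGE       `SubpolynomialBlocking → Q → Q_conf → KTail`                           `stub_kTailOfDecoupling` LANDED p141300 (wave 1; proved from
      the landed `stub_step` internals: two staircase rounds give `AprioriV (2 - 2σ)`, then `StubStepCount.markov_bigN` +
      `StubStep.sum_price_le` at `k = ⌈n^s⌉`) — the MONOTONICITY CERTIFICATE of the reshape: the old open pair (Q, Q_conf) implies
      the new single input KTail (given 4446), so the reshape loses nothing; it is not a hypothesis of `BoundaryTwoArmDecay_of`.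

`BoundaryTwoArmDecay_of : stub_kTail → stub_directStep → stub_slab → stub_reach → SubpolynomialBlocking → BoundaryTwoArmDecay`
(PROVED below: `σ = (6 - 5A)/16`, vertical exponent `3 - 3σ` from the direct step, sup exponent `b = 13/4 - 5A/8 > 5/2` from the reach
reduction since `bA < 3 - 3σ ⟺ (6/5 - A)(5/2 - A) > 0`, `κ = b - 5/2`).  The only foreign hypothesis is the TAGGED route item
`PercNonProliferation.SubpolynomialBlocking` (stmt-CriticalPhenomena-4446), by name.  The same composition replayed against the
landed theorems is LANDED as `Theorems.BoundaryTwoArmDecay.stub_kTailReduction` (p140944):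
`KTail → (∃ A ∈ [1,6/5), SlabCrossover A) → SubpolynomialBlocking → BoundaryTwoArmDecay` — crux A is CONDITIONAL on exactly
{KTail, stmt-6700⁺, stmt-4446}; the file's only `sorry`s are `stub_kTail` (NEW conjecture) and `stub_slab` (stmt-6700⁺).
PARAMETRIC form (LANDED p141852, `Theorems/…KTailAtReduction.lean`, registered sub-goals of the item): `stub_kTailAtReduction :
∀ c A, 0 < c → 1 ≤ A → 5A + 4c < 6 → KTailAt c → SlabCrossover A → SubpolynomialBlocking → BoundaryTwoArmDecay` — a FIXED
polynomial multiplicity loss `c` suffices (`KTailAt c`: eventually `n^{-c} P(A_n) ≤ P(A_n ∧ K_n ≤ ⌈n^c⌉)`; with the physical `A = 1` any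
`c < 1/4`), and `stub_kTailOfTight`: tightness of the conditional law of `K_n` on `A_n` (uniform in `n`) ⇒ KTail — the weakest and the
most natural entries of the menu of sufficient multiplicity inputs, for the planner who promotes `stub_kTail`.
FULLY PARAMETRIC form (LANDED p155856, `Theorems/…KTailAtBlockingAtReduction.lean`): `stub_kTailAtBlockingAtReduction :
∀ c t A, 0 < c → 0 < t → 1 ≤ A → 5A + 4c + 2t < 6 → KTailAt c → BlockingAt t → SlabCrossover A → BoundaryTwoArmDecay` — each of the
three open inputs at ONE exponent (`BlockingAt t`: eventually `n^{-t} ≤ u_n`, one exponent of stmt-4446; `StubTallDensity.density_bound_of_blockingAt`).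
INVERSE-MULTIPLICITY CENSUS (LANDED p156328, wave 2, `Theorems/…InverseMultiplicityCensus.lean`, UNCONDITIONAL):
`∫_{A_n} (max 1 K_n)⁻¹ dP ≤ 2 e_n / p_c³` for every `n` — the census with the truncation `K_n ≤ k` replaced by the weight `1/K_n`
(generic floor root transport `StubCensus.lintegral_rootTransport`); so crux A ⟺ (given 6700⁺, 4446) the inverse-multiplicity weighting
costs only `n^{o(1)}`: `HarmonicKTail : ∀ s > 0, ∀ᶠ n, n^{-s} P(A_n) ≤ ∫_{A_n} (max 1 K_n)⁻¹ dP`, equivalent to KTail up to `s ↦ 2s`.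
HARMONIC glue (LANDED p156980, `Theorems/…HarmonicKTail.lean`): `stub_harmonicKTailReduction : HarmonicKTail → (∃ A ∈ [1,6/5), SlabCrossover A) →
SubpolynomialBlocking → BoundaryTwoArmDecay` (direct from p156328; no census truncation parameter).

## History of the skeleton
* crux-plan (2026-08-16, sha be31aad6): 7 stubs census / tallDensity / floorDecoupling (Q) / confinement (Q_conf) / step / slab / reach.
* lead a5 (2026-08-16T23:5xZ, sha 8ef0db1d): landed census p132078, tallDensity p131461, step p131732, reach p130902; conditional
  reduction `stub_staircaseReduction` p132327 (`Q → Q_conf → Slab⁺ → 4446 → A`); kiss-density form p132481; sorries 7 → 3 (Q, Q_conf, slab).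
* lead c1 (this file, 2026-08-17T04:2xZ): the step consumed Q and Q_conf ONLY to bound the partner-kiss multiplicity `K_n` on
  `A_n`; that bound, in probability and subpolynomially (`KTail`), already closes the vertical exponent `3 - σ` with the census
  and 4446 directly.  Landed: `stub_directStep` + `stub_kTailReduction` p140944, bridge `stub_kTailOfDecoupling` p141300 (new debt
  {KTail, 6700⁺, 4446} ⟸ old debt {Q, Q_conf, 6700⁺, 4446}); sorries 4 → 2 (kTail, slab).  `stub_slab`: wave-1 worker audit —
  stmt-6700 open, 0 attempts, no quantitative slab-correlation-length theorem anywhere in the tree (stub-blocked: stmt-6700).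
* lead c1, later the same day: parametric p141852 (KTailAt c, tightness), fully parametric p155856 (one exponent each, 5A + 4c + 2t < 6),
  inverse-multiplicity census p156328 (unconditional, wave 2).  Strategist s3 prepared the SPLIT of the crux into
  {KissMultiplicityTail = stub_kTail, SlabCrossoverBelowSixFifths = stub_slab, AnnulusBlockingSubpolynomial = 4446} glued by
  `stub_kTailReduction` (Cruxes/BoundaryTwoArmDecay/SPLIT-PROPOSAL.md, SplitCertificate.lean); filing is the tenure planner's / final-cycle verb.

## Disproof used (`Cruxes/BoundaryTwoArmDecay/Disproof.lean` v5, unchanged since 2026-08-16T09:05Z; landed `Negative/LoadBearing`,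
## `Negative/OneArmLowerBound`, `Negative/SecondArm` — imported here)
`…_false_without_r_ge_one`: `AprioriV`/`Apriori` keep `1 ≤ n`, KTail / the bridge are `∀ᶠ n`.  `…_false_without_disjoint`,
`…_false_without_second_arm`: KTail is stated on `kissV n 0 1` (both arms AND the disjointness clause) and the partner of a partner-kiss
edge is n-tall — the one-armed / non-disjoint variants have density `≥ c n^{-2}` (`halfSpaceArm_ge`) and would contradict `stub_directStep`'s
conclusion, so no registered stub is an instance of a landed Negative lemma.  `halfSpaceArm_ge` / `quantitativeBGN_exponent_le_two`: no
one-arm rate enters (crux C is not used).  Targets §(d): none; near-misses §(e): none.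
-/

noncomputable section

namespace Summit.CriticalPhenomena.PercolationContinuityZ3.Cruxes.BoundaryTwoArmDecay.StaircaseBootstrapFloorDecoupling

open MeasureTheory Filter Topology
open Literature.Probability.Percolation Literature.Probability.LatticeModels
open Summit.CriticalPhenomena.PercolationContinuityZ3.Theorems.BoundaryTwoArmDecay.Negative
  (H e μ E boundaryTwoArmDecay_iff)
open Summit.CriticalPhenomena.PercolationContinuityZ3.Theses.PercLowPointHalfSpace (BoundaryTwoArmDecay)
open Summit.CriticalPhenomena.PercolationContinuityZ3.Theses.PercNonProliferation (SubpolynomialBlocking)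
open Summit.CriticalPhenomena.PercolationContinuityZ3.Theses.PercDivergentSlabLadder (SlabCrossoverPolynomial)

/-! ### Objects (readable local vocabulary; the registered stubs below INLINE all of them in tree vocabulary) -/

/-- `tallAt x n`: the `ℍ`-cluster of `x` meets level `n` (VERTICAL reach `≥ n` for a floor root `x`). -/
def tallAt (x : Site 3) (n : ℕ) : Set (BondConfig (Site 3)) :=
  {ω | ∃ y : Site 3, (n : ℤ) ≤ y 0 ∧ ω ∈ openConnIn (halfSpace 3) x y}

/-- `kissV n x j` — the vertical-reach KISS event at the floor edge `(x, x + e_j)`: both `ℍ`-clusters meet level `n`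
and are distinct.  `kissV n 0 1 ⊆ E n` is the crux event with sup-reach replaced by height. -/
def kissV (n : ℕ) (x : Site 3) (j : Fin 3) : Set (BondConfig (Site 3)) :=
  {ω | (∃ y : Site 3, (n : ℤ) ≤ y 0 ∧ ω ∈ openConnIn (halfSpace 3) x y) ∧
       (∃ y : Site 3, (n : ℤ) ≤ y 0 ∧ ω ∈ openConnIn (halfSpace 3) (x + Pi.single j 1) y) ∧
       ω ∉ openConnIn (halfSpace 3) x (x + Pi.single j 1)}

/-- A-priori VERTICAL two-arm exponent `a`: `P(kissV n 0 1) ≤ C n^{-a}` for `n ≥ 1`. -/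
def AprioriV (a : ℝ) : Prop :=
  ∃ C : ℝ, ∀ n : ℕ, 1 ≤ n → μ.real (kissV n 0 1) ≤ C * (n : ℝ) ^ (-a)

/-- Sup-norm two-arm exponent `b` for the crux event itself: `P(E r) ≤ C r^{-b}` for `r ≥ 1`. -/
def Apriori (b : ℝ) : Prop :=
  ∃ C : ℝ, ∀ r : ℕ, 1 ≤ r → μ.real (E r) ≤ C * (r : ℝ) ^ (-b)

/-- Floor sup-distance of a site from the normal axis. -/
def floorSup (x : Site 3) : ℕ := max (x 1).natAbs (x 2).natAbs

/-- **FLOOR DECOUPLING (Q)** at constant `C` beyond scale `d₀` (an input of the OLD skeleton, kept for the bridge). -/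
def FloorDecoupling (C : ℝ) (d₀ : ℕ) : Prop :=
  ∀ (j : Fin 3) (n m : ℕ) (x : Site 3), j ≠ 0 → x 0 = 0 → d₀ ≤ m → m ≤ n → 3 * m ≤ floorSup x →
    μ.real (kissV n 0 1 ∩ kissV m x j) ≤ C * μ.real (kissV n 0 1) * μ.real (kissV m x j)

/-- `U = C_ℍ(0)` stays inside the open sup-ball of radius `L`. -/
def confined (L : ℕ) : Set (BondConfig (Site 3)) :=
  {ω | ∀ y : Site 3, ω ∈ openConnIn (halfSpace 3) 0 y → ∀ i : Fin 3, |y i| < (L : ℤ)}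

/-- **CONFINEMENT (Q_conf)** with loss `s` (an input of the OLD skeleton, kept for the bridge). -/
def ConfinementLB (s : ℝ) : Prop :=
  ∀ᶠ n : ℕ in atTop, (n : ℝ) ^ (-s) * μ.real (kissV n 0 1) ≤ μ.real (kissV n 0 1 ∩ confined (3 * n))

/-- Partner-kiss edges of `U`: ordered floor edges `(q₁, q₂)` with `q₁ ∈ U`, `q₂ ∉ U`, `C_ℍ(q₂)` n-tall
(the pair's own further kiss edges AND third-party kisses). -/
def partnerKiss (n : ℕ) (ω : BondConfig (Site 3)) : Set (Site 3 × Site 3) :=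
  {q | q.1 0 = 0 ∧ q.2 0 = 0 ∧ (zdGraph 3).Adj q.1 q.2 ∧ ω ∈ openConnIn (halfSpace 3) 0 q.1 ∧
       ω ∉ openConnIn (halfSpace 3) 0 q.2 ∧ ∃ y : Site 3, (n : ℤ) ≤ y 0 ∧ ω ∈ openConnIn (halfSpace 3) q.2 y}

/-- `K_n` — their number (`Set.ncard`, `0` on infinite sets: a BGN-null event). -/
def kissCount (n : ℕ) (ω : BondConfig (Site 3)) : ℕ := (partnerKiss n ω).ncard

/-- `e_n := E[1{height U = n}/|U ∩ ∂ℍ|]` — exact-height (birth) density per floor site. -/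
def eDens (n : ℕ) : ENNReal :=
  ∫⁻ ω, {ω | (∃ y : Site 3, (n : ℤ) ≤ y 0 ∧ ω ∈ openConnIn (halfSpace 3) 0 y) ∧
      ¬ (∃ y : Site 3, ((n + 1 : ℕ) : ℤ) ≤ y 0 ∧ ω ∈ openConnIn (halfSpace 3) 0 y)}.indicator
    (fun ω => (((halfSpaceFootprint ω : ℕ∞) : ENNReal))⁻¹) ω ∂μ

/-- `ν_n := E[1{U n-tall}/|U ∩ ∂ℍ|]` — density of n-tall footed wall clusters per floor site (`Σ_{m ≥ n} e_m = ν_n`). -/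
def tallDens (n : ℕ) : ENNReal :=
  ∫⁻ ω, {ω | ∃ y : Site 3, (n : ℤ) ≤ y 0 ∧ ω ∈ openConnIn (halfSpace 3) 0 y}.indicator
    (fun ω => (((halfSpaceFootprint ω : ℕ∞) : ENNReal))⁻¹) ω ∂μ

/-- **CENSUS (truncated)**: `P(A_n ∧ K_n ≤ k) ≤ C·k·e_n`. -/
def CensusTruncated : Prop :=
  ∃ C : ℝ, ∀ n k : ℕ, 1 ≤ n → 1 ≤ k →
    μ.real (kissV n 0 1 ∩ {ω | kissCount n ω ≤ k}) ≤ C * (k : ℝ) * (eDens n).toReal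

/-- **TALL DENSITY**: `ν_n ≤ C_s n^{s-2}` for every `s > 0`. -/
def TallDensityBound : Prop :=
  ∀ s : ℝ, 0 < s → ∃ C : ℝ, ∀ n : ℕ, 1 ≤ n → tallDens n ≤ ENNReal.ofReal (C * (n : ℝ) ^ (s - 2))

/-- **One round of the OLD staircase** in vertical exponents (kept: the landed `stub_step` proves it from Q, Q_conf). -/
def StaircaseStepV : Prop :=
  ∀ a : ℝ, 0 ≤ a → AprioriV a → ∀ σ : ℝ, 0 < σ → AprioriV (3 - σ - max 0 (2 - a))

/-- **KTAIL** — subpolynomial partner-kiss multiplicity in probability: for every `s > 0`, eventually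
`n^{-s} P(A_n) ≤ P(A_n ∧ K_n ≤ ⌈n^s⌉)`. -/
def KTail : Prop :=
  ∀ s : ℝ, 0 < s → ∀ᶠ n : ℕ in atTop,
    (n : ℝ) ^ (-s) * μ.real (kissV n 0 1) ≤ μ.real (kissV n 0 1 ∩ {ω | kissCount n ω ≤ ⌈(n : ℝ) ^ s⌉₊})

/-- **DIRECT STEP**: `SubpolynomialBlocking → KTail → ∀ σ > 0, AprioriV (3 - σ)` (census + tall density, no staircase). -/
def DirectStepV : Prop :=
  SubpolynomialBlocking → KTail → ∀ σ : ℝ, 0 < σ → AprioriV (3 - σ)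

/-- Polynomial slab crossover with exponent `A` (the body of stmt-6700 `SlabCrossoverPolynomial` at a GIVEN `A`):
the slab `{|z 0| ≤ k}` at `p_c(ℤ³)` is exponentially subcritical beyond lateral scale `C k^A`. -/
def SlabCrossover (A : ℝ) : Prop :=
  ∃ C : ℝ, 0 < C ∧ ∀ k n : ℕ, 1 ≤ k → ∀ x : Site 3,
    μ.real {ω | ∃ y : Site 3, (n : ℤ) ≤ max |y 1 - x 1| |y 2 - x 2| ∧
      ω ∈ openConnIn {z : Site 3 | |z 0| ≤ (k : ℤ)} x y} ≤
        C * (k : ℝ) ^ C * Real.exp (-((n : ℝ) / (C * (k : ℝ) ^ A)))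

/-! ### Certificates: the local copies ARE the tree texts -/

/-- The crux, by name, is `∃ κ > 0, Apriori (5/2 + κ)` up to `Iff.rfl` bookkeeping (`Negative.boundaryTwoArmDecay_iff`). -/
theorem crux_iff :
    BoundaryTwoArmDecay ↔ ∃ κ C : ℝ, 0 < κ ∧ ∀ r : ℕ, 1 ≤ r → μ.real (E r) ≤ C * (r : ℝ) ^ (-(5 / 2 + κ)) :=
  boundaryTwoArmDecay_iff

/-- stmt-6700 is `∃ A > 0, SlabCrossover A`; `stub_slab` asks for a witness `A < 6/5` (w.l.o.g. `A ≥ 1`: the bound weakens as `A` grows). -/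
theorem slabCrossoverPolynomial_iff : SlabCrossoverPolynomial ↔ ∃ A : ℝ, 0 < A ∧ SlabCrossover A := by
  constructor
  · rintro ⟨A, C, hA, hC, h⟩
    exact ⟨A, hA, C, hC, h⟩
  · rintro ⟨A, hA, C, hC, h⟩
    exact ⟨A, C, hA, hC, h⟩

/-- `kissV n 0 1 ⊆ E n`: the vertical kiss event is a sub-event of the crux event (height `≥ n` is sup-reach `≥ n`). -/
theorem kissV_subset_E (n : ℕ) : kissV n 0 1 ⊆ E n := by
  rintro ω ⟨⟨y, hy, hc⟩, ⟨y', hy', hc'⟩, hne⟩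
  have he : (0 : Site 3) + Pi.single 1 1 = e := zero_add _
  rw [he] at hc' hne
  refine ⟨⟨y, ⟨0, ?_⟩, hc⟩, ⟨y', ⟨0, ?_⟩, hc'⟩, hne⟩
  · exact hy.trans (le_abs_self _)
  · have : e 0 = 0 := by simp [e]
    rw [this, sub_zero]; exact hy'.trans (le_abs_self _)

/-! ### Landed inputs (theorems of the tree, restated verbatim; NOT hypotheses of the composition any more) -/

/-- LANDED (p132078) — TRUNCATED LEVEL CENSUS: `P(A_n ∧ K_n ≤ k) ≤ C·k·e_n` for all `n, k ≥ 1` (`C = 2/p_c³`). -/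
theorem stub_census :
    ∃ C : ℝ, ∀ n k : ℕ, 1 ≤ n → 1 ≤ k →
      (bondPercolation (zdGraph 3) (criticalProbI 3)).real
          ({ω | (∃ y : Site 3, (n : ℤ) ≤ y 0 ∧ ω ∈ openConnIn (halfSpace 3) 0 y) ∧
              (∃ y : Site 3, (n : ℤ) ≤ y 0 ∧ ω ∈ openConnIn (halfSpace 3) ((0 : Site 3) + Pi.single 1 1) y) ∧
              ω ∉ openConnIn (halfSpace 3) 0 ((0 : Site 3) + Pi.single 1 1)} ∩
            {ω | {q : Site 3 × Site 3 | q.1 0 = 0 ∧ q.2 0 = 0 ∧ (zdGraph 3).Adj q.1 q.2 ∧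
                ω ∈ openConnIn (halfSpace 3) 0 q.1 ∧ ω ∉ openConnIn (halfSpace 3) 0 q.2 ∧
                ∃ y : Site 3, (n : ℤ) ≤ y 0 ∧ ω ∈ openConnIn (halfSpace 3) q.2 y}.ncard ≤ k}) ≤
        C * (k : ℝ) *
          (∫⁻ ω, {ω | (∃ y : Site 3, (n : ℤ) ≤ y 0 ∧ ω ∈ openConnIn (halfSpace 3) 0 y) ∧
                ¬ (∃ y : Site 3, ((n + 1 : ℕ) : ℤ) ≤ y 0 ∧ ω ∈ openConnIn (halfSpace 3) 0 y)}.indicator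
              (fun ω => (((halfSpaceFootprint ω : ℕ∞) : ENNReal))⁻¹) ω
              ∂(bondPercolation (zdGraph 3) (criticalProbI 3))).toReal :=
  _root_.Summit.CriticalPhenomena.PercolationContinuityZ3.Theorems.BoundaryTwoArmDecay.stub_census

/-- LANDED (p131461) — TALL DENSITY: `SubpolynomialBlocking → ∀ s > 0, ν_n ≤ C_s n^{s-2}`. -/
theorem stub_tallDensity :
    Summit.CriticalPhenomena.PercolationContinuityZ3.Theses.PercNonProliferation.SubpolynomialBlocking →
      ∀ s : ℝ, 0 < s → ∃ C : ℝ, ∀ n : ℕ, 1 ≤ n →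
        (∫⁻ ω, {ω | ∃ y : Site 3, (n : ℤ) ≤ y 0 ∧ ω ∈ openConnIn (halfSpace 3) 0 y}.indicator
            (fun ω => (((halfSpaceFootprint ω : ℕ∞) : ENNReal))⁻¹) ω
            ∂(bondPercolation (zdGraph 3) (criticalProbI 3))) ≤
          ENNReal.ofReal (C * (n : ℝ) ^ (s - 2)) :=
  _root_.Summit.CriticalPhenomena.PercolationContinuityZ3.Theorems.BoundaryTwoArmDecay.stub_tallDensity

/-- LANDED (p130902) — REACH REDUCTION (vertical exponent `a` ⇒ sup exponent `b` whenever `b·A < a`). -/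
theorem stub_reach :
    ∀ A : ℝ, 1 ≤ A →
      (∃ C : ℝ, 0 < C ∧ ∀ k n : ℕ, 1 ≤ k → ∀ x : Site 3,
        (bondPercolation (zdGraph 3) (criticalProbI 3)).real
            {ω | ∃ y : Site 3, (n : ℤ) ≤ max |y 1 - x 1| |y 2 - x 2| ∧
              ω ∈ openConnIn {z : Site 3 | |z 0| ≤ (k : ℤ)} x y} ≤
          C * (k : ℝ) ^ C * Real.exp (-((n : ℝ) / (C * (k : ℝ) ^ A)))) →
      ∀ a b : ℝ, 0 < b → b * A < a →
        (∃ C : ℝ, ∀ n : ℕ, 1 ≤ n →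
          (bondPercolation (zdGraph 3) (criticalProbI 3)).real
              {ω | (∃ y : Site 3, (n : ℤ) ≤ y 0 ∧ ω ∈ openConnIn (halfSpace 3) 0 y) ∧
                (∃ y : Site 3, (n : ℤ) ≤ y 0 ∧ ω ∈ openConnIn (halfSpace 3) ((0 : Site 3) + Pi.single 1 1) y) ∧
                ω ∉ openConnIn (halfSpace 3) 0 ((0 : Site 3) + Pi.single 1 1)} ≤ C * (n : ℝ) ^ (-a)) →
        ∃ C : ℝ, ∀ r : ℕ, 1 ≤ r →
          (bondPercolation (zdGraph 3) (criticalProbI 3)).real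
              {ω | (∃ y : Site 3, (∃ i : Fin 3, (r : ℤ) ≤ |y i|) ∧
                    ω ∈ openConnIn {x : Site 3 | 0 ≤ x 0} 0 y) ∧
                  (∃ y : Site 3, (∃ i : Fin 3, (r : ℤ) ≤ |y i - (Pi.single 1 1 : Site 3) i|) ∧
                    ω ∈ openConnIn {x : Site 3 | 0 ≤ x 0} (Pi.single 1 1 : Site 3) y) ∧
                  ω ∉ openConnIn {x : Site 3 | 0 ≤ x 0} 0 (Pi.single 1 1 : Site 3)} ≤ C * (r : ℝ) ^ (-b) :=
  _root_.Summit.CriticalPhenomena.PercolationContinuityZ3.Theorems.BoundaryTwoArmDecay.stub_reach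

/-! ### Registered stubs (the ONLY `sorry`s of this file; signatures fully inlined in tree vocabulary, each < 3900 chars) -/

/-- STUB (NEW conjecture, OPEN; held by the lead) — KTAIL: for every `s > 0`, eventually
`n^{-s} P(A_n) ≤ P(A_n ∧ K_n ≤ ⌈n^s⌉)` (`K_n` = `ncard` of the partner-kiss edges of `U = C_ℍ(0)`). -/
theorem stub_kTail :
    ∀ s : ℝ, 0 < s → ∀ᶠ n : ℕ in Filter.atTop,
      (n : ℝ) ^ (-s) *
          (bondPercolation (zdGraph 3) (criticalProbI 3)).real
            {ω | (∃ y : Site 3, (n : ℤ) ≤ y 0 ∧ ω ∈ openConnIn (halfSpace 3) 0 y) ∧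
              (∃ y : Site 3, (n : ℤ) ≤ y 0 ∧ ω ∈ openConnIn (halfSpace 3) ((0 : Site 3) + Pi.single 1 1) y) ∧
              ω ∉ openConnIn (halfSpace 3) 0 ((0 : Site 3) + Pi.single 1 1)} ≤
        (bondPercolation (zdGraph 3) (criticalProbI 3)).real
          ({ω | (∃ y : Site 3, (n : ℤ) ≤ y 0 ∧ ω ∈ openConnIn (halfSpace 3) 0 y) ∧
              (∃ y : Site 3, (n : ℤ) ≤ y 0 ∧ ω ∈ openConnIn (halfSpace 3) ((0 : Site 3) + Pi.single 1 1) y) ∧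
              ω ∉ openConnIn (halfSpace 3) 0 ((0 : Site 3) + Pi.single 1 1)} ∩
            {ω | {q : Site 3 × Site 3 | q.1 0 = 0 ∧ q.2 0 = 0 ∧ (zdGraph 3).Adj q.1 q.2 ∧
                ω ∈ openConnIn (halfSpace 3) 0 q.1 ∧ ω ∉ openConnIn (halfSpace 3) 0 q.2 ∧
                ∃ y : Site 3, (n : ℤ) ≤ y 0 ∧ ω ∈ openConnIn (halfSpace 3) q.2 y}.ncard ≤ ⌈(n : ℝ) ^ s⌉₊}) := by
  sorry

/-- STUB (LANDED p140944, lead c1) — DIRECT STEP: `SubpolynomialBlocking → KTail → ∀ σ > 0, AprioriV (3 - σ)`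
(KTail at loss `s`, the landed census `stub_census` with `k = ⌈n^s⌉`, the landed tall density `stub_tallDensity` at `t`,
dyadic averaging `StubStep.even_bound` with `A_n` antitone (`StubStep.kissV_antitone_level`) and
`Σ_{m∈[N,2N]} e_m ≤ ν_N` (`StubStep.sum_exactDens_toReal_le`), then `StubStep.decay_of_eventually`; `2s + t < σ`). -/
theorem stub_directStep :
    Summit.CriticalPhenomena.PercolationContinuityZ3.Theses.PercNonProliferation.SubpolynomialBlocking →
    (∀ s : ℝ, 0 < s → ∀ᶠ n : ℕ in Filter.atTop,
      (n : ℝ) ^ (-s) *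
          (bondPercolation (zdGraph 3) (criticalProbI 3)).real
            {ω | (∃ y : Site 3, (n : ℤ) ≤ y 0 ∧ ω ∈ openConnIn (halfSpace 3) 0 y) ∧
              (∃ y : Site 3, (n : ℤ) ≤ y 0 ∧ ω ∈ openConnIn (halfSpace 3) ((0 : Site 3) + Pi.single 1 1) y) ∧
              ω ∉ openConnIn (halfSpace 3) 0 ((0 : Site 3) + Pi.single 1 1)} ≤
        (bondPercolation (zdGraph 3) (criticalProbI 3)).real
          ({ω | (∃ y : Site 3, (n : ℤ) ≤ y 0 ∧ ω ∈ openConnIn (halfSpace 3) 0 y) ∧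
              (∃ y : Site 3, (n : ℤ) ≤ y 0 ∧ ω ∈ openConnIn (halfSpace 3) ((0 : Site 3) + Pi.single 1 1) y) ∧
              ω ∉ openConnIn (halfSpace 3) 0 ((0 : Site 3) + Pi.single 1 1)} ∩
            {ω | {q : Site 3 × Site 3 | q.1 0 = 0 ∧ q.2 0 = 0 ∧ (zdGraph 3).Adj q.1 q.2 ∧
                ω ∈ openConnIn (halfSpace 3) 0 q.1 ∧ ω ∉ openConnIn (halfSpace 3) 0 q.2 ∧
                ∃ y : Site 3, (n : ℤ) ≤ y 0 ∧ ω ∈ openConnIn (halfSpace 3) q.2 y}.ncard ≤ ⌈(n : ℝ) ^ s⌉₊})) →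
    ∀ σ : ℝ, 0 < σ → ∃ C : ℝ, ∀ n : ℕ, 1 ≤ n →
      (bondPercolation (zdGraph 3) (criticalProbI 3)).real
          {ω | (∃ y : Site 3, (n : ℤ) ≤ y 0 ∧ ω ∈ openConnIn (halfSpace 3) 0 y) ∧
            (∃ y : Site 3, (n : ℤ) ≤ y 0 ∧ ω ∈ openConnIn (halfSpace 3) ((0 : Site 3) + Pi.single 1 1) y) ∧
            ω ∉ openConnIn (halfSpace 3) 0 ((0 : Site 3) + Pi.single 1 1)} ≤ C * (n : ℝ) ^ (-(3 - σ)) :=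
  _root_.Summit.CriticalPhenomena.PercolationContinuityZ3.Theorems.BoundaryTwoArmDecay.stub_directStep

/-- STUB (XL, OPEN — stmt-6700 `PercDivergentSlabLadder.SlabCrossoverPolynomial` STRENGTHENED: its free exponent capped
below `6/5`; `1 ≤ A` is w.l.o.g. since the bound weakens as `A` grows; truth `A = 1`) — POLYNOMIAL SLAB CROSSOVER BELOW 6/5. -/
theorem stub_slab :
    ∃ A : ℝ, 1 ≤ A ∧ A < 6 / 5 ∧ ∃ C : ℝ, 0 < C ∧ ∀ k n : ℕ, 1 ≤ k → ∀ x : Site 3,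
      (bondPercolation (zdGraph 3) (criticalProbI 3)).real
          {ω | ∃ y : Site 3, (n : ℤ) ≤ max |y 1 - x 1| |y 2 - x 2| ∧
            ω ∈ openConnIn {z : Site 3 | |z 0| ≤ (k : ℤ)} x y} ≤
        C * (k : ℝ) ^ C * Real.exp (-((n : ℝ) / (C * (k : ℝ) ^ A))) := by
  sorry

/-- STUB (LANDED p141300, wave 1; the BRIDGE / monotonicity certificate of the reshape, NOT a hypothesis of the composition) —
`SubpolynomialBlocking → Q → Q_conf → KTail`: two rounds of the landed `stub_step` give `AprioriV (2 - 2σ)`; at a fixed large `n`,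
`StubStepCount.inter_conf_subset_union` + `markov_bigN` + `StubStep.sum_price_le`/`S_le` give
`P(A_n ∩ conf) ≤ P(A_n ∩ {K_n ≤ k}) + P(A_n) S(n)/(k+1)` with `S(n) ≲ n^{2σ+δ}`; with `k = ⌈n^s⌉`, Q_conf at loss `s/2` and `2σ + δ < s/2`
the second term is absorbed for large `n`. -/
theorem stub_kTailOfDecoupling :
    Summit.CriticalPhenomena.PercolationContinuityZ3.Theses.PercNonProliferation.SubpolynomialBlocking →
    (∃ C : ℝ, ∃ d₀ : ℕ, ∀ (j : Fin 3) (n m : ℕ) (x : Site 3), j ≠ 0 → x 0 = 0 → d₀ ≤ m → m ≤ n →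
      3 * m ≤ max (x 1).natAbs (x 2).natAbs →
        (bondPercolation (zdGraph 3) (criticalProbI 3)).real
            ({ω | (∃ y : Site 3, (n : ℤ) ≤ y 0 ∧ ω ∈ openConnIn (halfSpace 3) 0 y) ∧
                (∃ y : Site 3, (n : ℤ) ≤ y 0 ∧ ω ∈ openConnIn (halfSpace 3) ((0 : Site 3) + Pi.single 1 1) y) ∧
                ω ∉ openConnIn (halfSpace 3) 0 ((0 : Site 3) + Pi.single 1 1)} ∩
              {ω | (∃ y : Site 3, (m : ℤ) ≤ y 0 ∧ ω ∈ openConnIn (halfSpace 3) x y) ∧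
                (∃ y : Site 3, (m : ℤ) ≤ y 0 ∧ ω ∈ openConnIn (halfSpace 3) (x + Pi.single j 1) y) ∧
                ω ∉ openConnIn (halfSpace 3) x (x + Pi.single j 1)}) ≤
          C * (bondPercolation (zdGraph 3) (criticalProbI 3)).real
              {ω | (∃ y : Site 3, (n : ℤ) ≤ y 0 ∧ ω ∈ openConnIn (halfSpace 3) 0 y) ∧
                (∃ y : Site 3, (n : ℤ) ≤ y 0 ∧ ω ∈ openConnIn (halfSpace 3) ((0 : Site 3) + Pi.single 1 1) y) ∧
                ω ∉ openConnIn (halfSpace 3) 0 ((0 : Site 3) + Pi.single 1 1)} *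
            (bondPercolation (zdGraph 3) (criticalProbI 3)).real
              {ω | (∃ y : Site 3, (m : ℤ) ≤ y 0 ∧ ω ∈ openConnIn (halfSpace 3) x y) ∧
                (∃ y : Site 3, (m : ℤ) ≤ y 0 ∧ ω ∈ openConnIn (halfSpace 3) (x + Pi.single j 1) y) ∧
                ω ∉ openConnIn (halfSpace 3) x (x + Pi.single j 1)}) →
    (∀ s : ℝ, 0 < s → ∀ᶠ n : ℕ in Filter.atTop,
      (n : ℝ) ^ (-s) *
          (bondPercolation (zdGraph 3) (criticalProbI 3)).real
            {ω | (∃ y : Site 3, (n : ℤ) ≤ y 0 ∧ ω ∈ openConnIn (halfSpace 3) 0 y) ∧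
              (∃ y : Site 3, (n : ℤ) ≤ y 0 ∧ ω ∈ openConnIn (halfSpace 3) ((0 : Site 3) + Pi.single 1 1) y) ∧
              ω ∉ openConnIn (halfSpace 3) 0 ((0 : Site 3) + Pi.single 1 1)} ≤
        (bondPercolation (zdGraph 3) (criticalProbI 3)).real
          ({ω | (∃ y : Site 3, (n : ℤ) ≤ y 0 ∧ ω ∈ openConnIn (halfSpace 3) 0 y) ∧
              (∃ y : Site 3, (n : ℤ) ≤ y 0 ∧ ω ∈ openConnIn (halfSpace 3) ((0 : Site 3) + Pi.single 1 1) y) ∧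
              ω ∉ openConnIn (halfSpace 3) 0 ((0 : Site 3) + Pi.single 1 1)} ∩
            {ω | ∀ y : Site 3, ω ∈ openConnIn (halfSpace 3) 0 y → ∀ i : Fin 3, |y i| < ((3 * n : ℕ) : ℤ)})) →
    ∀ s : ℝ, 0 < s → ∀ᶠ n : ℕ in Filter.atTop,
      (n : ℝ) ^ (-s) *
          (bondPercolation (zdGraph 3) (criticalProbI 3)).real
            {ω | (∃ y : Site 3, (n : ℤ) ≤ y 0 ∧ ω ∈ openConnIn (halfSpace 3) 0 y) ∧
              (∃ y : Site 3, (n : ℤ) ≤ y 0 ∧ ω ∈ openConnIn (halfSpace 3) ((0 : Site 3) + Pi.single 1 1) y) ∧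
              ω ∉ openConnIn (halfSpace 3) 0 ((0 : Site 3) + Pi.single 1 1)} ≤
        (bondPercolation (zdGraph 3) (criticalProbI 3)).real
          ({ω | (∃ y : Site 3, (n : ℤ) ≤ y 0 ∧ ω ∈ openConnIn (halfSpace 3) 0 y) ∧
              (∃ y : Site 3, (n : ℤ) ≤ y 0 ∧ ω ∈ openConnIn (halfSpace 3) ((0 : Site 3) + Pi.single 1 1) y) ∧
              ω ∉ openConnIn (halfSpace 3) 0 ((0 : Site 3) + Pi.single 1 1)} ∩
            {ω | {q : Site 3 × Site 3 | q.1 0 = 0 ∧ q.2 0 = 0 ∧ (zdGraph 3).Adj q.1 q.2 ∧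
                ω ∈ openConnIn (halfSpace 3) 0 q.1 ∧ ω ∉ openConnIn (halfSpace 3) 0 q.2 ∧
                ∃ y : Site 3, (n : ℤ) ≤ y 0 ∧ ω ∈ openConnIn (halfSpace 3) q.2 y}.ncard ≤ ⌈(n : ℝ) ^ s⌉₊}) :=
  _root_.Summit.CriticalPhenomena.PercolationContinuityZ3.Theorems.BoundaryTwoArmDecay.stub_kTailOfDecoupling

/-! ### Consistency: each named statement IS its registered stub / landed input (definitionally) -/

theorem census_holds : CensusTruncated := stub_census
theorem tallDensity_holds : SubpolynomialBlocking → TallDensityBound := stub_tallDensity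
theorem kTail_holds : KTail := stub_kTail
theorem directStep_holds : DirectStepV := stub_directStep
theorem slab_holds : ∃ A : ℝ, 1 ≤ A ∧ A < 6 / 5 ∧ SlabCrossover A := stub_slab
theorem reach_holds :
    ∀ A : ℝ, 1 ≤ A → SlabCrossover A → ∀ a b : ℝ, 0 < b → b * A < a → AprioriV a → Apriori b := stub_reach
theorem kTailOfDecoupling_holds :
    SubpolynomialBlocking → (∃ C : ℝ, ∃ d₀ : ℕ, FloorDecoupling C d₀) → (∀ s : ℝ, 0 < s → ConfinementLB s) → KTail :=
  stub_kTailOfDecoupling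
/-- The landed `stub_step` (p131732) in the local vocabulary (used by the bridge; not by the composition). -/
theorem step_holds :
    CensusTruncated → TallDensityBound → (∃ C : ℝ, ∃ d₀ : ℕ, FloorDecoupling C d₀) →
      (∀ s : ℝ, 0 < s → ConfinementLB s) → StaircaseStepV :=
  _root_.Summit.CriticalPhenomena.PercolationContinuityZ3.Theorems.BoundaryTwoArmDecay.stub_step

/-! ### Name-keyed aliases (hypotheses of the composition) -/
namespace Registered

/-- Alias keyed by the registered stub name. -/
abbrev stub_kTail : Prop := KTail
/-- Alias keyed by the registered stub name. -/
abbrev stub_directStep : Prop := DirectStepV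
/-- Alias keyed by the registered stub name. -/
abbrev stub_slab : Prop := ∃ A : ℝ, 1 ≤ A ∧ A < 6 / 5 ∧ SlabCrossover A
/-- Alias keyed by the registered stub name (LANDED). -/
abbrev stub_reach : Prop :=
  ∀ A : ℝ, 1 ≤ A → SlabCrossover A → ∀ a b : ℝ, 0 < b → b * A < a → AprioriV a → Apriori b

end Registered

/-! ### Glue (PROVED): vertical exponent `3 - 3σ` in one stroke, then the reach reduction and `κ = b - 5/2` -/

section Glue

/-- **Composition** (kernel-checked, no `sorry` of its own): the registered stubs `stub_kTail`, `stub_directStep`,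
`stub_slab`, `stub_reach` and the tagged foreign item `PercNonProliferation.SubpolynomialBlocking`
(stmt-CriticalPhenomena-4446) give the crux BY NAME. -/
theorem BoundaryTwoArmDecay_of (h₁ : Registered.stub_kTail) (h₂ : Registered.stub_directStep)
    (h₃ : Registered.stub_slab) (h₄ : Registered.stub_reach)
    (hB : Summit.CriticalPhenomena.PercolationContinuityZ3.Theses.PercNonProliferation.SubpolynomialBlocking) :
    BoundaryTwoArmDecay := by
  -- the slab exponent A ∈ [1, 6/5) fixes the losses
  obtain ⟨A, hA1, hA65, hSlab⟩ := h₃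
  set σ : ℝ := (6 - 5 * A) / 16 with hσdef
  have hσ : 0 < σ := by rw [hσdef]; linarith
  -- the direct step at loss 3σ: vertical exponent 3 - 3σ = (30 + 15A)/16
  have hV : AprioriV (3 - 3 * σ) := h₂ hB h₁ (3 * σ) (by positivity)
  -- reach: sup exponent b = 13/4 - 5A/8 > 5/2, admissible since bA < 3 - 3σ ⟺ (6/5 - A)(5/2 - A) > 0
  set b : ℝ := 13 / 4 - 5 * A / 8 with hbdef
  have hb52 : (5 : ℝ) / 2 < b := by rw [hbdef]; linarith
  have hb : 0 < b := by linarith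
  have hbA : b * A < 3 - 3 * σ := by
    rw [hbdef, hσdef]
    nlinarith [mul_pos (sub_pos.2 hA65) (sub_pos.2 (show A < 5 / 2 by linarith))]
  obtain ⟨C, hC⟩ := h₄ A hA1 hSlab (3 - 3 * σ) b hb hbA hV
  -- κ = b - 5/2
  rw [crux_iff]
  refine ⟨b - 5 / 2, C, by linarith, fun r hr => ?_⟩
  have hexp : (-(5 / 2 + (b - 5 / 2)) : ℝ) = -b := by ring
  rw [hexp]
  exact hC r hr

/-- Wiring check: the registered stubs feed `BoundaryTwoArmDecay_of` as stated (conditional on stmt-4446, by name). -/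
theorem BoundaryTwoArmDecay_proof
    (hB : Summit.CriticalPhenomena.PercolationContinuityZ3.Theses.PercNonProliferation.SubpolynomialBlocking) :
    BoundaryTwoArmDecay :=
  BoundaryTwoArmDecay_of stub_kTail stub_directStep stub_slab stub_reach hB

/-- The reshape loses nothing: the OLD open pair (Q, Q_conf) still closes the crux through the new skeleton
(bridge `stub_kTailOfDecoupling`, then `BoundaryTwoArmDecay_of`). -/
theorem BoundaryTwoArmDecay_of_decoupling (hQ : ∃ C : ℝ, ∃ d₀ : ℕ, FloorDecoupling C d₀)
    (hConf : ∀ s : ℝ, 0 < s → ConfinementLB s) (h₂ : Registered.stub_directStep)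
    (h₃ : Registered.stub_slab) (h₄ : Registered.stub_reach)
    (hB : Summit.CriticalPhenomena.PercolationContinuityZ3.Theses.PercNonProliferation.SubpolynomialBlocking) :
    BoundaryTwoArmDecay :=
  BoundaryTwoArmDecay_of (kTailOfDecoupling_holds hB hQ hConf) h₂ h₃ h₄ hB

end Glue

end Summit.CriticalPhenomena.PercolationContinuityZ3.Cruxes.BoundaryTwoArmDecay.StaircaseBootstrapFloorDecoupling

end
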